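import Summits.QuantumFields.YangMills.Theorems.BalabanUVNodesN20CoreEdgeShellDialAtKeyReading
import Summits.QuantumFields.YangMills.Theorems.BalabanUVNodesK3V6Defs
import Summits.QuantumFields.YangMills.Theorems.BalabanUVNodesSpineReadingOfRecord13CoPHVSlot
import Summits.QuantumFields.YangMills.Theorems.BalabanUVNodesN20BadDialEliminationAtKeyReading

/-!
# BalabanUVNodes ∕ N20·N21·N19′ — the `hedge`-JOINT COMPANION, module 13V: K3⁸ BY NAME FROM THE LETTERS AT A KEY READING OF THE PROVER'S CHOICE —
# NOTHING OF (Dev), NO PIN.  At dag-n20-d's key-reading edition `crOfRecord₁₃K kr bd sh` of the spine reading of record (coarse carriers: `classSetK₁₃`,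
# `weightAK₁₃`, `weightBK₁₃`, `badClassK₁₃` — the record's fine class weights summed along the dial `kr`), with `sh := sh⋆` module 13K's ℓ¹-optimal split of the
# COARSE weights, the five faces of the item are: N19′ OUTRIGHT (13K), N21 from the ℓ¹ letter AT `kr` (13K), N20 from any keyed witness AT `kr` (free at the empty bad-key
# reading), N27x from the keyed live line (dag-n20-d); dag-n27-w1's `spineGivenEndpointR13SepCoPHV_of_facesV` — which takes ANY spine reading — then gives the ROUTE DECL
# `Theses.BalabanUVNodes.SpineGivenEndpointR13SepCoPHV` from K4 + the live line + ONE two-run letter read at `kr` (the keyed-hybrid-certificate form is the sibling module 13W)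

Cell `pub-ymgap` (HUMAN RULING D-0062 Track A; D-0149 width push), seat `pub-ymgap-dag-n20-w3` (WIDTH SEAT 3 of 3 on NODE n20 = NE7b) gen 9, CLAIM-1 ∕ INTENT-1
(pub-ymgap INBOX l.38916).  Filed `--kind proof --supports stmt-QuantumFields-27366 --as helper` (K3⁸ `SpineGivenEndpointR13SepCoPHV`, skeleton v6 b4e55110ab73e679; dag-lead
KEY MAP v2; the aside K3⁷ display `SpineGivenEndpointR13SepCoPH` = stmt-QuantumFields-20544 is served by §2's last theorem from the same letters).  COUNT-NEUTRAL.  ADDITIVE —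
imports this lineage's module 13K `…N20CoreEdgeShellDialAtKeyReading` (gen 6, p615422: `exists_optShellSplitK`, `core_crOfRecord₁₃KAt_optShell`,
`shellWeightBound_crOfRecord₁₃KAt_optShell_of_l1MismatchK ∕ _of_l1Mismatch`; through it module 13 and dag-n20-d's K edition `…SpineReadingOfRecord13CoPHK` p608328 with its
transfers `relWeightBound_∕shellWeightBound_∕core_crOfRecord₁₃KAt`), dag-n27-w1's mirror `…K3V6Defs` (p625739: the face predicates, the transfer lemmas `…V_of_bFree ∕ …_of_bFree`,
`spineGivenEndpointR13SepCoPHV_of_facesV`; through it `K3V5Defs` and dag-n19-w3's composer `keyedGuarded₁₃CoPH_of_keyedFacesP_fsc`), dag-n20-d's `…SpineReadingOfRecord13CoPHVSlot`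
v1.1 (p637963: `keyedExtraction_crOfRecord₁₃KAt_abs` — E1 ∕ E2 at EVERY key reading from `LiveSel ∧ ZetaMeasurable` only) and dag-n20-w1's `…N20BadDialEliminationAtKeyReading`
(p617228: `badClassK₁₃_false`, `relWeightBound_crOfRecord₁₃KAt_badFalse`) — all BY NAME; modifies nothing.  Inside the theses cone (via `K3V5Defs`) like 13b ∕ 13R ∕ 13T ∕ 13U.
[LF-II] = [Balaban1989LargeFieldII], [King1986] = CMP 102, [III] = [Balaban1988Convergent] (locations only).

WHY.  Gen 6's HANDOFF (t2) and gen 7's located word («v5's pinned (N19′, N21) pair over-asks, relative to the same pair at a window key `wkey`, by EXACTLY (Dev at wkey); a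
`kr := wkey` pin with shells free books (W)+(N20) at wkey and NOTHING of (Dev)») deferred the `K3V6Defs`-level companion of module 13K §2 to a K3 skeleton registering a key-reading
dial.  No such skeleton is needed to say it about the ITEM: the mirror's `spineGivenEndpointR13SepCoPHV_of_facesV ∕ …_of_facesBFree` take an ARBITRARY spine reading `cr`, and
dag-n20-d's `crOfRecord₁₃K kr bd sh : SpineReading₁₃CoPH 2` IS one for every key reading `kr`, bad-key reading `bd` and shell split `sh` (dag-n21-d's pin-free knit
`spineGivenEndpointR13SepCoPHV_of_gapRoad` at the gapped reading `crGap₁₃V` is the precedent on another reading).  So, per guarded admissible Stage-13 tuple and `(g₀, os)`: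
* §1 THE FIVE FACES AT `crK⋆ := crOfRecord₁₃K kr bd sh⋆` (`sh⋆` reads 13K's ℓ¹-optimal split of the `kr`-COARSE weights at a constant reading `cK`; a witness:
  `exists_optShellSplitK 0 kr cK`): ★★★ `keyedCoreEdgeHolderD4BFree_crOfRecord₁₃K_optShell` ∕ `…D4V…` ∕ `…D4…` (N19′ OUTRIGHT — every `kr`, `bd`, `β`, rate reading, version; 13K
  `core_crOfRecord₁₃KAt_optShell`) · ★★ `keyedShellWeight_crOfRecord₁₃K_optShell_of_l1LetterK` (N21 from (Wₖᵣ): the two one-sided ℓ¹ class-matching letters of the `kr`-coarse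
  weights modulo the constants `e^{∓cK_K}`, summable fraction `w ≥ 0`; 13K) · ★★ `…_of_l1Letter` (N21 at EVERY `kr` from the same letter at the FINE key — 13K's descent) · ★
  `keyedRelWeight_crOfRecord₁₃K_of_witnessK` (N20 from ANY `RelWeightBound` witness at the `kr`-carriers, any `sh`; dag-n20-d's transfer — dag-n20-w2's
  `relWeightBound_crOfRecord₁₃KAt_of_survival_ageFloor` & co. are such witnesses) · ★ `keyedRelWeight_crOfRecord₁₃K_badFalse` (N20 FREE at the EMPTY bad-key reading `⊥`, dag-n20-w1)
  · ★★ `keyedExtractionBFree_crOfRecord₁₃K_of_liveLine` ∕ `…V…` ∕ `keyedExtraction_…` (N27x at EVERY `kr`, `bd`, `sh` from the keyed live line `LiveSel ∧ ZetaMeasurable`; dag-n20-d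
  p637963) · ★★ `exists_optShell_facesK_of_lettersK` (the four reading-level faces bundled: `∃ sh`, N20 ∧ N21 ∧ N27x ∧ ∀ β rr, N19′).
* §2 K3⁸ BY NAME: ★★★ `spineGivenEndpointR13SepCoPHV_of_ratesV_of_liveLine_of_lettersK` (⇐ K4 `KeyedRatesHolderD4V β rr` + keyed live line + per tuple TWO letters AT `kr`: (N20ₖᵣ) a
  `RelWeightBound` witness at the `kr`-carriers with bad-key reading `bd`, (Wₖᵣ) the ℓ¹ letter — NO (Dev), NO pin, NO `W + w < 1` row) · ★★★
  `spineGivenEndpointR13SepCoPHV_of_ratesV_of_liveLine_of_l1LetterK` (`bd := ⊥`: K3⁸ ⇐ K4 + live line + ONE letter «summable one-sided ℓ¹ class-matching modulo constants of the two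
  runs' class weights READ AT THE KEY READING `kr`», all coarse classes) · ★★ `spineGivenEndpointR13SepCoPHV_of_stubRates13HVText_of_liveLine_of_l1LetterK` (⊢ the item modulo
  stub 1's REGISTERED v6 text `stub_rates13HV`, whose guard rows are unread) · ★★ `spineGivenEndpointR13SepCoPHV_of_ratesBFree_of_liveLine_of_l1LetterK` ∕ ★★
  `spineGivenEndpointR13SepCoPH_of_ratesBFree_of_liveLine_of_l1LetterK` (from the (B)-FREE K4 face BOTH displays — K3⁸ and the aside K3⁷ `SpineGivenEndpointR13SepCoPH`
  (stmt-QuantumFields-20544) — via the mirror's transfers and dag-n19-w3's composer: ONE (B)-free road, two displays, as the (δⱽ) recipe promises).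
(The sibling module 13W `…N20KeyedHybridCertificateAtKeyReadingK3V6` does the same from a keyed no-bad-class HYBRID CERTIFICATE at the `kr`-coarse carriers — 13U one key up.)
LOCATED (said, not decided; evidence note on stmt-QuantumFields-27366): on the ℓ¹-optimal-shell road the ITEM K3⁸ reads, beyond K4 and the keyed live line, exactly ONE two-run
letter at a key reading OF THE PROVER'S CHOICE — (W at `kr`), with (N20 at `kr`) only if a bad-key reading is kept (foldable: dag-n19-w1 `shellWeightBound_foldBad`, dag-n20-w1
`stubTwoBodyK_iff_badFalse`); the REGISTERED TEXT `stub_expansion13HV` reads, for every `kr`, (W at `kr`) ∧ (Dev at `kr`) (module 13N `pinnedLetters_iff_keyReadingLetters_and_fibreDev`)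
— (Dev) is the price of the text's pin `PinnedAtLive` (the σ-packed FULL-history key: `crK⋆` meets it only at `kr := keyReadingId₁₃`, `bd := badKeyReadingOfCut₁₃ …`, dag-n20-d's
`crOfRecord₁₃K_id`), not of the item; a v7 that pins `cr := crOfRecord₁₃K wkey bd sh` with `sh` free makes the text's bill equal the item's bill on this road (window-key-core K3 ∕ D1;
dag-n20-d's `windowKeyReading₁₃` ∕ `…KForgive` ∕ `…KFloorVolume` are VALUES of `kr`, read here as a parameter).

HONEST FRAMING.  By-name plumbing + classical choice over the tree's SHAPES; proves NO estimate; (Wₖᵣ) ∕ (N20ₖᵣ) are the two-run ∕ NE7b content at a coarse key — NOT PRINTED for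
`d = 4`, NOT proved, produced by nobody, inhabited for no Bałaban family today (K0⁷ `Record13SepCoPHInhabited` OPEN); K4 ∕ stub 1's text and the live line are HYPOTHESES; NOT a
proof of `stub_expansion13HV` (its `PinnedAtLive` is not served by `crK⋆`) nor of K3⁸ ∕ K3⁷ (the §2 theorems conclude the decls BY NAME from DISPLAYED
hypotheses — audit class `proof.conditional`, credits nothing); nothing of Bałaban's asserted; NE7 ∕ NE7b ∕ NE7c NOT PROVED; N19 ∕ N20 ∕ N21 ∕ N27x NOT discharged; K3⁸ OPEN, v6
STANDS, not claimed; K3⁷ aside; counts unmoved (typed 28∕28 · discharged 5∕27); no count claim.  One finite `𝕋⁴_{L^K}` programme at fixed `ε = L^{−K}`, Bałaban AS PRINTED — R4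
closes the conditional finite-𝕋⁴ rung `BalabanLadder.UV` only; the YM mass gap (Clay) is NOT proved by any of this; NOT ℝ⁴, NOT continuum, NOT OS.  No `def`, no `instance`, no
`notation`, no `sorry`, no private decls.  Sources (location only): [King1986] (3.10)–(3.13) pp.656–657; [LF-II] Thm 1 + (0.1) pp.355–356, (1.80) p.384; [III] (2.18) p.257, (3.23) p.270.
-/

noncomputable section

open Finset
open scoped BigOperators

namespace Summit.QuantumFields.YangMills.BalabanUVNodes.N20CoreEdgeShellDialAtKeyReadingK3V6

open Literature.MathematicalPhysics.QuantumFieldTheory.Balaban1983to89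
open Literature.MathematicalPhysics.QuantumFieldTheory.Balaban1983to89.T4Continuum
open Literature.MathematicalPhysics.QuantumFieldTheory.Balaban1983to89.Node00
open T4WeightBudget (RelWeightBound)
open T4IndicatorShell (ShellWeightBound)
open T4ContinuumYM4Torus (ForSmallCouplings)
open Summit.QuantumFields.BalabanUV.T4Continuum.Spine
open YMDAG.UVSplit hiding SU
open Summit.QuantumFields.YangMills.Theorems.K3V5Defs (SpineReading RateReadingFn RunSel LetterReading CutReading rrOfRecord GuardedReadingN16 PHolderD4
  KeyedRatesHolderD4 KeyedRelWeight KeyedShellWeight KeyedCoreEdgeHolderD4 KeyedExtraction LiveSel)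
open Summit.QuantumFields.YangMills.Theorems.K3V6Defs (KeyedRatesHolderD4V KeyedRatesHolderD4BFree KeyedCoreEdgeHolderD4V KeyedCoreEdgeHolderD4BFree KeyedExtractionV
  KeyedExtractionBFree keyedRatesHolderD4V_of_bFree keyedRatesHolderD4_of_bFree keyedCoreEdgeHolderD4V_of_bFree keyedCoreEdgeHolderD4_of_bFree keyedExtractionV_of_bFree
  keyedExtraction_of_bFree spineGivenEndpointR13SepCoPHV_of_facesV)
open Summit.QuantumFields.YangMills.BalabanUVNodes.N20CoreEdgeShellDialAtKeyReading (exists_optShellSplitK core_crOfRecord₁₃KAt_optShell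
  shellWeightBound_crOfRecord₁₃KAt_optShell_of_l1MismatchK shellWeightBound_crOfRecord₁₃KAt_optShell_of_l1Mismatch)
open Summit.QuantumFields.YangMills.BalabanUVNodes.N20BadDialEliminationAtKeyReading (relWeightBound_crOfRecord₁₃KAt_badFalse)
open Summit.QuantumFields.YangMills.BalabanUVNodes.N19CoreEdgeFSCComposer (keyedGuarded₁₃CoPH_of_keyedFacesP_fsc)

-- the dials, read PER TUPLE (bare function types, no def — as in modules 13b ∕ 13R): the key reading `kr`, the bad-key reading `bd`, the shell split `sh`, the constants `cK`
variable (kr : KeyReading₁₃ 2 0) (bd : BadKeyReading₁₃ 2 0) (sh : ShellSplit₁₃CoPH 2 0)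
  (cK : (F : T4Family) → (θ : Stage13HParams F 2) → θ.Provisos₁₃CoPH F 2 → (ℕ → ℝ) → List (ULoop F) → ℕ → ℝ)
  /- the displayed row «`sh` reads, at every tuple, module 13K's ℓ¹-optimal split of the `kr`-COARSE class weights at the constants `cK`» (a witness: 13K's
  `exists_optShellSplitK 0 kr cK`) -/
  (hsh : ∀ (F : T4Family) (θ : Stage13HParams F 2) (hP : θ.Provisos₁₃CoPH F 2) (g₀ : ℕ → ℝ) (os : List (ULoop F)),
    sh F θ hP g₀ os =
      (fun K t u => max 0 (weightAK₁₃ θ hP 0 g₀ os (kr F θ hP g₀ os) K t u - Real.exp (-cK F θ hP g₀ os K) * weightBK₁₃ θ hP 0 g₀ os (kr F θ hP g₀ os) K t u),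
       fun K t u => max 0 (weightBK₁₃ θ hP 0 g₀ os (kr F θ hP g₀ os) K t u - Real.exp (cK F θ hP g₀ os K) * weightAK₁₃ θ hP 0 g₀ os (kr F θ hP g₀ os) K t u)))

/-! ## §1 The five faces of the item AT the key-reading edition `crOfRecord₁₃K kr bd sh` -/

section Faces

include hsh in
/-- **★★★ N19′'s (B)-FREE FACE HOLDS OUTRIGHT AT `crK⋆ := crOfRecord₁₃K kr bd sh⋆` — EVERY KEY READING, EVERY BAD-KEY READING, EVERY `β`, EVERY RATE READING.**  Under
`ForSmallCouplings` (by `.of_forall`) the holder premise `PHolderD4 β D (rr …)` is NOT READ and `∃ δ, Core … ∧ Summable δ` is module 13K's `core_crOfRecord₁₃KAt_optShell` at the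
reading's own canonical rate (`K₀ = 0`).  The N19′∕N21 division is degenerate at the ℓ¹-optimal shells at ANY key (13K). [cite: King1986, (3.10)–(3.13) pp.656–657 (template only)]
[bookkeeping] -/
theorem keyedCoreEdgeHolderD4BFree_crOfRecord₁₃K_optShell (β : ℝ) (rr : RateReadingFn) :
    KeyedCoreEdgeHolderD4BFree β (crOfRecord₁₃K kr bd sh) rr := by
  intro F θ hP _ _
  refine ForSmallCouplings.of_forall fun g₀ os _ => ?_
  exact ⟨_, core_crOfRecord₁₃KAt_optShell 0 kr bd sh θ hP g₀ os (cK F θ hP g₀ os) (hsh F θ hP g₀ os)⟩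

include hsh in
/-- **★★★ N19′'s SLOT-KEYED FACE OF K3⁸ (`KeyedCoreEdgeHolderD4V`, v6) AT `crK⋆`, EVERY VERSION** (the (B)-free face through dag-n27-w1's transfer). [bookkeeping] -/
theorem keyedCoreEdgeHolderD4V_crOfRecord₁₃K_optShell (β : ℝ) (rr : RateReadingFn) :
    KeyedCoreEdgeHolderD4V β (crOfRecord₁₃K kr bd sh) rr :=
  keyedCoreEdgeHolderD4V_of_bFree (keyedCoreEdgeHolderD4BFree_crOfRecord₁₃K_optShell kr bd sh cK hsh β rr)

include hsh in
/-- … and v5's (B)-keyed face `KeyedCoreEdgeHolderD4` (the aside K3⁷'s N19′ conjunct) AT `crK⋆`. [bookkeeping] -/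
theorem keyedCoreEdgeHolderD4_crOfRecord₁₃K_optShell (β : ℝ) (rr : RateReadingFn) :
    KeyedCoreEdgeHolderD4 β (crOfRecord₁₃K kr bd sh) rr :=
  keyedCoreEdgeHolderD4_of_bFree (keyedCoreEdgeHolderD4BFree_crOfRecord₁₃K_optShell kr bd sh cK hsh β rr)

include hsh in
/-- **★★ N21's FACE AT `crK⋆` FROM THE ℓ¹ LETTER READ AT THE KEY READING** (any bad-key reading `bd`): per guarded admissible tuple and `(g₀, os)`, a summable fraction `w ≥ 0`
with the two one-sided ℓ¹ class-matching sums of the `kr`-COARSE weights modulo the constants `e^{∓cK_K}` at most `w K` times the coarse totals on `|t| ≤ 1` ⇒ `KeyedShellWeight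
crK⋆` (canonical `Wsh`; 13K's `shellWeightBound_crOfRecord₁₃KAt_optShell_of_l1MismatchK`).  The letter IS the two-run matching content at the coarse key — NOT PRINTED for `d = 4`, NOT
proved. [cite: Balaban1989LargeFieldII, Thm 1 + (0.1) pp.355–356, (1.80) p.384 (templates only)] [bookkeeping] -/
theorem keyedShellWeight_crOfRecord₁₃K_optShell_of_l1LetterK
    (hW : ∀ (F : T4Family) (θ : Stage13HParams F 2) (hP : θ.Provisos₁₃CoPH F 2), (θ.ZhUnity F 2 ∧ θ.SlotsNondegenerate₁₃ F 2) → θ.Admissible F 2 →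
      ∀ (g₀ : ℕ → ℝ) (os : List (ULoop F)), ∃ w : ℕ → ℝ, (∀ K, 0 ≤ w K) ∧ Summable w ∧ ∀ (K : ℕ) (t : ℝ), |t| ≤ 1 →
        (∑ u ∈ classSetK₁₃ θ 0 g₀ (kr F θ hP g₀ os) K,
            max 0 (weightAK₁₃ θ hP 0 g₀ os (kr F θ hP g₀ os) K t u - Real.exp (-cK F θ hP g₀ os K) * weightBK₁₃ θ hP 0 g₀ os (kr F θ hP g₀ os) K t u)
          ≤ w K * ∑ u ∈ classSetK₁₃ θ 0 g₀ (kr F θ hP g₀ os) K, weightAK₁₃ θ hP 0 g₀ os (kr F θ hP g₀ os) K t u) ∧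
        (∑ u ∈ classSetK₁₃ θ 0 g₀ (kr F θ hP g₀ os) K,
            max 0 (weightBK₁₃ θ hP 0 g₀ os (kr F θ hP g₀ os) K t u - Real.exp (cK F θ hP g₀ os K) * weightAK₁₃ θ hP 0 g₀ os (kr F θ hP g₀ os) K t u)
          ≤ w K * ∑ u ∈ classSetK₁₃ θ 0 g₀ (kr F θ hP g₀ os) K, weightBK₁₃ θ hP 0 g₀ os (kr F θ hP g₀ os) K t u)) :
    KeyedShellWeight (crOfRecord₁₃K kr bd sh) := by
  intro F θ hP hG hθ g₀ os
  obtain ⟨w, hw0, hws, h⟩ := hW F θ hP hG hθ g₀ os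
  exact shellWeightBound_crOfRecord₁₃KAt_optShell_of_l1MismatchK 0 kr bd sh θ hP g₀ os (cK F θ hP g₀ os) (hsh F θ hP g₀ os) hw0 hws
    (fun K t ht => (h K t ht).1) (fun K t ht => (h K t ht).2)

include hsh in
/-- **★★ N21's FACE AT `crK⋆` — EVERY KEY READING — FROM THE ℓ¹ LETTER AT THE FINE KEY** (module 13's letter on `weightA₁₃ ∕ weightB₁₃` over `classSet₁₃`, same constants,
same fraction: 13K's DESCENT `shellWeightBound_crOfRecord₁₃KAt_optShell_of_l1Mismatch`).  NOT PRINTED for `d = 4`, NOT proved.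
[cite: Balaban1989LargeFieldII, Thm 1 + (0.1) pp.355–356 (template only)] [bookkeeping] -/
theorem keyedShellWeight_crOfRecord₁₃K_optShell_of_l1Letter
    (hW : ∀ (F : T4Family) (θ : Stage13HParams F 2) (hP : θ.Provisos₁₃CoPH F 2), (θ.ZhUnity F 2 ∧ θ.SlotsNondegenerate₁₃ F 2) → θ.Admissible F 2 →
      ∀ (g₀ : ℕ → ℝ) (os : List (ULoop F)), ∃ w : ℕ → ℝ, (∀ K, 0 ≤ w K) ∧ Summable w ∧ ∀ (K : ℕ) (t : ℝ), |t| ≤ 1 →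
        (∑ x ∈ classSet₁₃ θ 0 g₀ K, max 0 (weightA₁₃ θ hP 0 g₀ os K t x - Real.exp (-cK F θ hP g₀ os K) * weightB₁₃ θ hP 0 g₀ os K t x)
          ≤ w K * ∑ x ∈ classSet₁₃ θ 0 g₀ K, weightA₁₃ θ hP 0 g₀ os K t x) ∧
        (∑ x ∈ classSet₁₃ θ 0 g₀ K, max 0 (weightB₁₃ θ hP 0 g₀ os K t x - Real.exp (cK F θ hP g₀ os K) * weightA₁₃ θ hP 0 g₀ os K t x)
          ≤ w K * ∑ x ∈ classSet₁₃ θ 0 g₀ K, weightB₁₃ θ hP 0 g₀ os K t x)) :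
    KeyedShellWeight (crOfRecord₁₃K kr bd sh) := by
  intro F θ hP hG hθ g₀ os
  obtain ⟨w, hw0, hws, h⟩ := hW F θ hP hG hθ g₀ os
  exact shellWeightBound_crOfRecord₁₃KAt_optShell_of_l1Mismatch 0 kr bd sh θ hP g₀ os (cK F θ hP g₀ os) (hsh F θ hP g₀ os) hw0 hws
    (fun K t ht => (h K t ht).1) (fun K t ht => (h K t ht).2)

/-- **★ N20's FACE AT `crOfRecord₁₃K kr bd sh` FROM ANY KEYED WITNESS AT THE `kr`-CARRIERS** (any shell split): per guarded admissible tuple and `(g₀, os)` SOME `W` with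
`RelWeightBound 1 (classSetK₁₃ …) (weightAK₁₃ …) (weightBK₁₃ …) (badClassK₁₃ … bd …) W` ⇒ `KeyedRelWeight` (the reading's canonical `W` is the least witness; dag-n20-d's
`relWeightBound_crOfRecord₁₃KAt`).  The witness is NE7b's content at the coarse key — NOT PRINTED for `d = 4`, NOT proved (dag-n20-w2's `…N20KeyedRelWeightAtKeyReading`
`relWeightBound_crOfRecord₁₃KAt_of_levelFractions` ∕ `…AtForgivingKey` `…_of_survival_ageFloor` ∕ `…AnyCarriers` type CONDITIONAL witnesses of this shape, read back through
`relWeightBound_crOfRecord₁₃KAt_iff`). [cite: Balaban1988Convergent, (3.23) p.270 (the relative weights; template only)] [bookkeeping] -/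
theorem keyedRelWeight_crOfRecord₁₃K_of_witnessK
    (h20 : ∀ (F : T4Family) (θ : Stage13HParams F 2) (hP : θ.Provisos₁₃CoPH F 2), (θ.ZhUnity F 2 ∧ θ.SlotsNondegenerate₁₃ F 2) → θ.Admissible F 2 →
      ∀ (g₀ : ℕ → ℝ) (os : List (ULoop F)), ∃ W : ℕ → ℝ,
        RelWeightBound 1 (classSetK₁₃ θ 0 g₀ (kr F θ hP g₀ os)) (weightAK₁₃ θ hP 0 g₀ os (kr F θ hP g₀ os)) (weightBK₁₃ θ hP 0 g₀ os (kr F θ hP g₀ os))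
          (badClassK₁₃ θ 0 g₀ (kr F θ hP g₀ os) (bd F θ hP g₀ os)) W) :
    KeyedRelWeight (crOfRecord₁₃K kr bd sh) := by
  intro F θ hP hG hθ g₀ os
  obtain ⟨W, hW⟩ := h20 F θ hP hG hθ g₀ os
  exact relWeightBound_crOfRecord₁₃KAt 0 kr bd sh θ hP g₀ os hW

/-- **★ N20's FACE IS FREE AT THE EMPTY BAD-KEY READING `⊥`** — every key reading, every shell split (dag-n20-w1's `relWeightBound_crOfRecord₁₃KAt_badFalse`: the coarse bad class is
`∅`, the witness `W := 0`). [bookkeeping] -/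
theorem keyedRelWeight_crOfRecord₁₃K_badFalse : KeyedRelWeight (crOfRecord₁₃K kr (fun _ _ _ _ _ _ _ => False) sh) :=
  fun _ θ hP _ _ g₀ os => relWeightBound_crOfRecord₁₃KAt_badFalse 0 kr sh θ hP g₀ os

/-- The witness form of the same: at `bd := ⊥` the `∃ W` premise of `keyedRelWeight_crOfRecord₁₃K_of_witnessK` holds at every tuple (read back through dag-n20-d's `rfl` dictionary
from dag-n20-w1's lemma at the zero split). [bookkeeping] -/
theorem exists_relWeightBound_carriersK_badFalse {F : T4Family} (θ : Stage13HParams F 2) (hP : θ.Provisos₁₃CoPH F 2) (g₀ : ℕ → ℝ) (os : List (ULoop F)) :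
    ∃ W : ℕ → ℝ, RelWeightBound 1 (classSetK₁₃ θ 0 g₀ (kr F θ hP g₀ os)) (weightAK₁₃ θ hP 0 g₀ os (kr F θ hP g₀ os)) (weightBK₁₃ θ hP 0 g₀ os (kr F θ hP g₀ os))
      (badClassK₁₃ θ 0 g₀ (kr F θ hP g₀ os) fun _ _ => False) W :=
  ⟨_, relWeightBound_crOfRecord₁₃KAt_badFalse 0 kr (fun _ _ _ _ _ => (fun _ _ _ => 0, fun _ _ _ => 0)) θ hP g₀ os⟩

/-- **★★ N27x's (B)-FREE FACE AT `crOfRecord₁₃K kr bd sh` — EVERY KEY READING, BAD-KEY READING, SHELL SPLIT — FROM THE KEYED LIVE LINE `LiveSel ∧ ZetaMeasurable`**: E1 ∕ E2 are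
the totals of the COARSE class weights whatever the dial (re-keying preserves totals), (H-U) and `ζ ≥ 0` supplied (dag-n20-d's `keyedExtraction_crOfRecord₁₃KAt_abs`, p637963).
[cite: Balaban1988Convergent, (3.23) p.270 (the representation; template only)] [bookkeeping] -/
theorem keyedExtractionBFree_crOfRecord₁₃K_of_liveLine
    (hlive : ∀ (F : T4Family) (θ : Stage13HParams F 2), θ.Provisos₁₃CoPH F 2 → (θ.ZhUnity F 2 ∧ θ.SlotsNondegenerate₁₃ F 2) → θ.Admissible F 2 →
      LiveSel F θ ∧ ZetaMeasurable F 2 θ.ζ) :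
    KeyedExtractionBFree (crOfRecord₁₃K kr bd sh) := by
  intro F θ hP hG hθ
  obtain ⟨hsel, hζm⟩ := hlive F θ hP hG hθ
  exact keyedExtraction_crOfRecord₁₃KAt_abs 0 kr bd sh θ hP (EOfRecord₁₃ F 2 θ.toStage13Params) hsel hζm

/-- … the slot-keyed face `KeyedExtractionV` of K3⁸ (every version; the mirror's transfer). [bookkeeping] -/
theorem keyedExtractionV_crOfRecord₁₃K_of_liveLine
    (hlive : ∀ (F : T4Family) (θ : Stage13HParams F 2), θ.Provisos₁₃CoPH F 2 → (θ.ZhUnity F 2 ∧ θ.SlotsNondegenerate₁₃ F 2) → θ.Admissible F 2 →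
      LiveSel F θ ∧ ZetaMeasurable F 2 θ.ζ) :
    KeyedExtractionV (crOfRecord₁₃K kr bd sh) :=
  keyedExtractionV_of_bFree (keyedExtractionBFree_crOfRecord₁₃K_of_liveLine kr bd sh hlive)

/-- … and v5's face `KeyedExtraction` (the aside K3⁷'s N27x conjunct). [bookkeeping] -/
theorem keyedExtraction_crOfRecord₁₃K_of_liveLine
    (hlive : ∀ (F : T4Family) (θ : Stage13HParams F 2), θ.Provisos₁₃CoPH F 2 → (θ.ZhUnity F 2 ∧ θ.SlotsNondegenerate₁₃ F 2) → θ.Admissible F 2 →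
      LiveSel F θ ∧ ZetaMeasurable F 2 θ.ζ) :
    KeyedExtraction (crOfRecord₁₃K kr bd sh) :=
  keyedExtraction_of_bFree (keyedExtractionBFree_crOfRecord₁₃K_of_liveLine kr bd sh hlive)

/-- **★★ THE FOUR READING-LEVEL FACES BUNDLED** (every key reading `kr`, every bad-key reading `bd`): from the keyed live line, a keyed N20 witness at the `kr`-carriers and,
per guarded admissible tuple and `(g₀, os)`, SOME constants `c` and a summable fraction `w ≥ 0` carrying the two ℓ¹ class-matching letters of the `kr`-coarse weights — a shell
split `sh` (13K's ℓ¹-optimal split at constants CHOSEN per tuple: classical choice on the guard, `0` constants elsewhere) with, at `crOfRecord₁₃K kr bd sh`: `KeyedRelWeight ∧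
KeyedShellWeight ∧ KeyedExtractionBFree ∧ ∀ β rr, KeyedCoreEdgeHolderD4BFree β … rr`.  Every letter a HYPOTHESIS. [bookkeeping] -/
theorem exists_optShell_facesK_of_lettersK
    (hlive : ∀ (F : T4Family) (θ : Stage13HParams F 2), θ.Provisos₁₃CoPH F 2 → (θ.ZhUnity F 2 ∧ θ.SlotsNondegenerate₁₃ F 2) → θ.Admissible F 2 →
      LiveSel F θ ∧ ZetaMeasurable F 2 θ.ζ)
    (h20 : ∀ (F : T4Family) (θ : Stage13HParams F 2) (hP : θ.Provisos₁₃CoPH F 2), (θ.ZhUnity F 2 ∧ θ.SlotsNondegenerate₁₃ F 2) → θ.Admissible F 2 →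
      ∀ (g₀ : ℕ → ℝ) (os : List (ULoop F)), ∃ W : ℕ → ℝ,
        RelWeightBound 1 (classSetK₁₃ θ 0 g₀ (kr F θ hP g₀ os)) (weightAK₁₃ θ hP 0 g₀ os (kr F θ hP g₀ os)) (weightBK₁₃ θ hP 0 g₀ os (kr F θ hP g₀ os))
          (badClassK₁₃ θ 0 g₀ (kr F θ hP g₀ os) (bd F θ hP g₀ os)) W)
    (hW : ∀ (F : T4Family) (θ : Stage13HParams F 2) (hP : θ.Provisos₁₃CoPH F 2), (θ.ZhUnity F 2 ∧ θ.SlotsNondegenerate₁₃ F 2) → θ.Admissible F 2 →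
      ∀ (g₀ : ℕ → ℝ) (os : List (ULoop F)), ∃ c w : ℕ → ℝ, (∀ K, 0 ≤ w K) ∧ Summable w ∧ ∀ (K : ℕ) (t : ℝ), |t| ≤ 1 →
        (∑ u ∈ classSetK₁₃ θ 0 g₀ (kr F θ hP g₀ os) K,
            max 0 (weightAK₁₃ θ hP 0 g₀ os (kr F θ hP g₀ os) K t u - Real.exp (-c K) * weightBK₁₃ θ hP 0 g₀ os (kr F θ hP g₀ os) K t u)
          ≤ w K * ∑ u ∈ classSetK₁₃ θ 0 g₀ (kr F θ hP g₀ os) K, weightAK₁₃ θ hP 0 g₀ os (kr F θ hP g₀ os) K t u) ∧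
        (∑ u ∈ classSetK₁₃ θ 0 g₀ (kr F θ hP g₀ os) K,
            max 0 (weightBK₁₃ θ hP 0 g₀ os (kr F θ hP g₀ os) K t u - Real.exp (c K) * weightAK₁₃ θ hP 0 g₀ os (kr F θ hP g₀ os) K t u)
          ≤ w K * ∑ u ∈ classSetK₁₃ θ 0 g₀ (kr F θ hP g₀ os) K, weightBK₁₃ θ hP 0 g₀ os (kr F θ hP g₀ os) K t u)) :
    ∃ sh : ShellSplit₁₃CoPH 2 0, KeyedRelWeight (crOfRecord₁₃K kr bd sh) ∧ KeyedShellWeight (crOfRecord₁₃K kr bd sh) ∧ KeyedExtractionBFree (crOfRecord₁₃K kr bd sh) ∧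
      ∀ (β : ℝ) (rr : RateReadingFn), KeyedCoreEdgeHolderD4BFree β (crOfRecord₁₃K kr bd sh) rr := by
  -- the constants CHOSEN per tuple: the letter's `c` at guarded admissible tuples, `0` elsewhere (classical case split on the guard, no global `classical`)
  let cK : (F : T4Family) → (θ : Stage13HParams F 2) → θ.Provisos₁₃CoPH F 2 → (ℕ → ℝ) → List (ULoop F) → ℕ → ℝ := fun F θ hP g₀ os =>
    @dite _ ((θ.ZhUnity F 2 ∧ θ.SlotsNondegenerate₁₃ F 2) ∧ θ.Admissible F 2) (Classical.dec _)
      (fun h => (hW F θ hP h.1 h.2 g₀ os).choose) (fun _ => fun _ => 0)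
  have hcK : ∀ (F : T4Family) (θ : Stage13HParams F 2) (hP : θ.Provisos₁₃CoPH F 2) (hG : θ.ZhUnity F 2 ∧ θ.SlotsNondegenerate₁₃ F 2) (hθ : θ.Admissible F 2)
      (g₀ : ℕ → ℝ) (os : List (ULoop F)), cK F θ hP g₀ os = (hW F θ hP hG hθ g₀ os).choose := fun F θ hP hG hθ g₀ os =>
    dif_pos (show (θ.ZhUnity F 2 ∧ θ.SlotsNondegenerate₁₃ F 2) ∧ θ.Admissible F 2 from ⟨hG, hθ⟩)
  obtain ⟨sh, hsh⟩ := exists_optShellSplitK 0 kr cK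
  refine ⟨sh, keyedRelWeight_crOfRecord₁₃K_of_witnessK kr bd sh h20, ?_, keyedExtractionBFree_crOfRecord₁₃K_of_liveLine kr bd sh hlive,
    keyedCoreEdgeHolderD4BFree_crOfRecord₁₃K_optShell kr bd sh cK hsh⟩
  refine keyedShellWeight_crOfRecord₁₃K_optShell_of_l1LetterK kr bd sh cK hsh fun F θ hP hG hθ g₀ os => ?_
  obtain ⟨w, hw0, hws, h⟩ := (hW F θ hP hG hθ g₀ os).choose_spec
  refine ⟨w, hw0, hws, fun K t ht => ?_⟩
  rw [hcK F θ hP hG hθ g₀ os]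
  exact h K t ht

end Faces

/-! ## §2 K3⁸ BY NAME from K4 + the keyed live line + the letters AT the key reading (dag-n27-w1's `spineGivenEndpointR13SepCoPHV_of_facesV` at `cr := crOfRecord₁₃K kr bd sh⋆`) -/

section Item

/-- **★★★ K3⁸ BY NAME FROM K4, THE KEYED LIVE LINE AND TWO LETTERS READ AT THE KEY READING `kr` — NOTHING OF (Dev), NO PIN.**  Hypotheses: `hr` the K4 face
`KeyedRatesHolderD4V β rr` (stub 1's last conjunct at v6); `hlive` the keyed live line; `h20` a keyed `RelWeightBound` witness at the `kr`-carriers with bad-key reading `bd` (N20ₖᵣ);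
`hW` the ℓ¹ letter at `kr` (Wₖᵣ).  Conclusion: the ROUTE DECL `Theses.BalabanUVNodes.SpineGivenEndpointR13SepCoPHV` (stmt-QuantumFields-27366) — ONE application of the mirror's
`spineGivenEndpointR13SepCoPHV_of_facesV` at `(β, crOfRecord₁₃K kr bd sh⋆, rr)` with §1's faces.  NO `W + w < 1` row is read (the composer's business).  Every hypothesis is
DISPLAYED and inhabited for no family today — NOT a proof of K3⁸ (audit `proof.conditional`). [cite: Balaban1989LargeFieldII, (1.80) p.384 (the window key, template only)]
[bookkeeping] -/
theorem spineGivenEndpointR13SepCoPHV_of_ratesV_of_liveLine_of_lettersK (β : ℝ) (rr : RateReadingFn) (hr : KeyedRatesHolderD4V β rr)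
    (hlive : ∀ (F : T4Family) (θ : Stage13HParams F 2), θ.Provisos₁₃CoPH F 2 → (θ.ZhUnity F 2 ∧ θ.SlotsNondegenerate₁₃ F 2) → θ.Admissible F 2 →
      LiveSel F θ ∧ ZetaMeasurable F 2 θ.ζ)
    (h20 : ∀ (F : T4Family) (θ : Stage13HParams F 2) (hP : θ.Provisos₁₃CoPH F 2), (θ.ZhUnity F 2 ∧ θ.SlotsNondegenerate₁₃ F 2) → θ.Admissible F 2 →
      ∀ (g₀ : ℕ → ℝ) (os : List (ULoop F)), ∃ W : ℕ → ℝ,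
        RelWeightBound 1 (classSetK₁₃ θ 0 g₀ (kr F θ hP g₀ os)) (weightAK₁₃ θ hP 0 g₀ os (kr F θ hP g₀ os)) (weightBK₁₃ θ hP 0 g₀ os (kr F θ hP g₀ os))
          (badClassK₁₃ θ 0 g₀ (kr F θ hP g₀ os) (bd F θ hP g₀ os)) W)
    (hW : ∀ (F : T4Family) (θ : Stage13HParams F 2) (hP : θ.Provisos₁₃CoPH F 2), (θ.ZhUnity F 2 ∧ θ.SlotsNondegenerate₁₃ F 2) → θ.Admissible F 2 →
      ∀ (g₀ : ℕ → ℝ) (os : List (ULoop F)), ∃ c w : ℕ → ℝ, (∀ K, 0 ≤ w K) ∧ Summable w ∧ ∀ (K : ℕ) (t : ℝ), |t| ≤ 1 →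
        (∑ u ∈ classSetK₁₃ θ 0 g₀ (kr F θ hP g₀ os) K,
            max 0 (weightAK₁₃ θ hP 0 g₀ os (kr F θ hP g₀ os) K t u - Real.exp (-c K) * weightBK₁₃ θ hP 0 g₀ os (kr F θ hP g₀ os) K t u)
          ≤ w K * ∑ u ∈ classSetK₁₃ θ 0 g₀ (kr F θ hP g₀ os) K, weightAK₁₃ θ hP 0 g₀ os (kr F θ hP g₀ os) K t u) ∧
        (∑ u ∈ classSetK₁₃ θ 0 g₀ (kr F θ hP g₀ os) K,
            max 0 (weightBK₁₃ θ hP 0 g₀ os (kr F θ hP g₀ os) K t u - Real.exp (c K) * weightAK₁₃ θ hP 0 g₀ os (kr F θ hP g₀ os) K t u)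
          ≤ w K * ∑ u ∈ classSetK₁₃ θ 0 g₀ (kr F θ hP g₀ os) K, weightBK₁₃ θ hP 0 g₀ os (kr F θ hP g₀ os) K t u)) :
    Summit.QuantumFields.YangMills.Theses.BalabanUVNodes.SpineGivenEndpointR13SepCoPHV := by
  obtain ⟨sh, h20', h21, hx, h19⟩ := exists_optShell_facesK_of_lettersK kr bd hlive h20 hW
  exact spineGivenEndpointR13SepCoPHV_of_facesV β (crOfRecord₁₃K kr bd sh) rr h20' h21 hr (keyedCoreEdgeHolderD4V_of_bFree (h19 β rr)) (keyedExtractionV_of_bFree hx)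

/-- **★★★ K3⁸ BY NAME FROM K4, THE KEYED LIVE LINE AND ONE LETTER: «SUMMABLE ONE-SIDED ℓ¹ CLASS-MATCHING MODULO CONSTANTS OF THE TWO RUNS' CLASS WEIGHTS READ AT THE KEY
READING `kr`»** — the `bd := ⊥` instance of the previous theorem (empty bad-key reading: N20 FREE, §1), the letter over ALL coarse classes.  On the ℓ¹-optimal-shell road this is the
item's whole two-run bill at a key of the prover's choice; the REGISTERED text `stub_expansion13HV` asks the same letter ∧ (Dev at `kr`) (module 13N) — the pin's price, not the
item's.  NOT a proof of K3⁸ (every hypothesis displayed; `proof.conditional`). [cite: Balaban1989LargeFieldII, (1.80) p.384 (template only)] [bookkeeping] -/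
theorem spineGivenEndpointR13SepCoPHV_of_ratesV_of_liveLine_of_l1LetterK (β : ℝ) (rr : RateReadingFn) (hr : KeyedRatesHolderD4V β rr)
    (hlive : ∀ (F : T4Family) (θ : Stage13HParams F 2), θ.Provisos₁₃CoPH F 2 → (θ.ZhUnity F 2 ∧ θ.SlotsNondegenerate₁₃ F 2) → θ.Admissible F 2 →
      LiveSel F θ ∧ ZetaMeasurable F 2 θ.ζ)
    (hW : ∀ (F : T4Family) (θ : Stage13HParams F 2) (hP : θ.Provisos₁₃CoPH F 2), (θ.ZhUnity F 2 ∧ θ.SlotsNondegenerate₁₃ F 2) → θ.Admissible F 2 →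
      ∀ (g₀ : ℕ → ℝ) (os : List (ULoop F)), ∃ c w : ℕ → ℝ, (∀ K, 0 ≤ w K) ∧ Summable w ∧ ∀ (K : ℕ) (t : ℝ), |t| ≤ 1 →
        (∑ u ∈ classSetK₁₃ θ 0 g₀ (kr F θ hP g₀ os) K,
            max 0 (weightAK₁₃ θ hP 0 g₀ os (kr F θ hP g₀ os) K t u - Real.exp (-c K) * weightBK₁₃ θ hP 0 g₀ os (kr F θ hP g₀ os) K t u)
          ≤ w K * ∑ u ∈ classSetK₁₃ θ 0 g₀ (kr F θ hP g₀ os) K, weightAK₁₃ θ hP 0 g₀ os (kr F θ hP g₀ os) K t u) ∧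
        (∑ u ∈ classSetK₁₃ θ 0 g₀ (kr F θ hP g₀ os) K,
            max 0 (weightBK₁₃ θ hP 0 g₀ os (kr F θ hP g₀ os) K t u - Real.exp (c K) * weightAK₁₃ θ hP 0 g₀ os (kr F θ hP g₀ os) K t u)
          ≤ w K * ∑ u ∈ classSetK₁₃ θ 0 g₀ (kr F θ hP g₀ os) K, weightBK₁₃ θ hP 0 g₀ os (kr F θ hP g₀ os) K t u)) :
    Summit.QuantumFields.YangMills.Theses.BalabanUVNodes.SpineGivenEndpointR13SepCoPHV :=
  spineGivenEndpointR13SepCoPHV_of_ratesV_of_liveLine_of_lettersK kr (fun _ _ _ _ _ _ _ => False) β rr hr hlive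
    (fun _ θ hP _ _ g₀ os => exists_relWeightBound_carriersK_badFalse kr θ hP g₀ os) hW

/-- **★★ THE ITEM MODULO STUB 1's REGISTERED v6 TEXT** (`stub_rates13HV`, verbatim over `K3V6Defs` as in the mirror's `spineGivenEndpointR13SepCoPHV_of_stubTextsV`): its `β`-window
and N16-guard rows are unread, its last conjunct `KeyedRatesHolderD4V β (rrOfRecord 𝔯 ksel)` feeds the previous theorem.  ⊢ `SpineGivenEndpointR13SepCoPHV` BY NAME from DISPLAYED
hypotheses — NOT a proof of K3⁸, credits nothing. [bookkeeping] -/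
theorem spineGivenEndpointR13SepCoPHV_of_stubRates13HVText_of_liveLine_of_l1LetterK
    (h₁ : ∃ β : ℝ, 2 / 3 < β ∧ β < 1 ∧
      ∃ (𝔯 : RateReading₁₃CoPH 2) (ksel : RunSel) (ℓ : LetterReading) (ℓ₃ : T4Family → Node00.NE3Letters₁₁) (g B : T4Family → ℝ),
        GuardedReadingN16 𝔯 ksel ℓ ℓ₃ g B ∧ KeyedRatesHolderD4V β (rrOfRecord 𝔯 ksel))
    (hlive : ∀ (F : T4Family) (θ : Stage13HParams F 2), θ.Provisos₁₃CoPH F 2 → (θ.ZhUnity F 2 ∧ θ.SlotsNondegenerate₁₃ F 2) → θ.Admissible F 2 →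
      LiveSel F θ ∧ ZetaMeasurable F 2 θ.ζ)
    (hW : ∀ (F : T4Family) (θ : Stage13HParams F 2) (hP : θ.Provisos₁₃CoPH F 2), (θ.ZhUnity F 2 ∧ θ.SlotsNondegenerate₁₃ F 2) → θ.Admissible F 2 →
      ∀ (g₀ : ℕ → ℝ) (os : List (ULoop F)), ∃ c w : ℕ → ℝ, (∀ K, 0 ≤ w K) ∧ Summable w ∧ ∀ (K : ℕ) (t : ℝ), |t| ≤ 1 →
        (∑ u ∈ classSetK₁₃ θ 0 g₀ (kr F θ hP g₀ os) K,
            max 0 (weightAK₁₃ θ hP 0 g₀ os (kr F θ hP g₀ os) K t u - Real.exp (-c K) * weightBK₁₃ θ hP 0 g₀ os (kr F θ hP g₀ os) K t u)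
          ≤ w K * ∑ u ∈ classSetK₁₃ θ 0 g₀ (kr F θ hP g₀ os) K, weightAK₁₃ θ hP 0 g₀ os (kr F θ hP g₀ os) K t u) ∧
        (∑ u ∈ classSetK₁₃ θ 0 g₀ (kr F θ hP g₀ os) K,
            max 0 (weightBK₁₃ θ hP 0 g₀ os (kr F θ hP g₀ os) K t u - Real.exp (c K) * weightAK₁₃ θ hP 0 g₀ os (kr F θ hP g₀ os) K t u)
          ≤ w K * ∑ u ∈ classSetK₁₃ θ 0 g₀ (kr F θ hP g₀ os) K, weightBK₁₃ θ hP 0 g₀ os (kr F θ hP g₀ os) K t u)) :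
    Summit.QuantumFields.YangMills.Theses.BalabanUVNodes.SpineGivenEndpointR13SepCoPHV := by
  obtain ⟨β, -, -, 𝔯, ksel, _ℓ, _ℓ₃, _g, _B, -, hr⟩ := h₁
  exact spineGivenEndpointR13SepCoPHV_of_ratesV_of_liveLine_of_l1LetterK kr β (rrOfRecord 𝔯 ksel) hr hlive hW

/-- **★★ K3⁸ BY NAME FROM THE (B)-FREE K4 FACE** (`KeyedRatesHolderD4BFree β rr` — what every ∀-`g₀` ∕ (B)-blind rates road proves; the mirror's transfer `keyedRatesHolderD4V_of_bFree`),
the keyed live line and the ONE ℓ¹ letter at `kr`.  ⊢ `SpineGivenEndpointR13SepCoPHV` BY NAME from DISPLAYED hypotheses — NOT a proof of K3⁸, credits nothing. [bookkeeping] -/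
theorem spineGivenEndpointR13SepCoPHV_of_ratesBFree_of_liveLine_of_l1LetterK (β : ℝ) (rr : RateReadingFn) (hr : KeyedRatesHolderD4BFree β rr)
    (hlive : ∀ (F : T4Family) (θ : Stage13HParams F 2), θ.Provisos₁₃CoPH F 2 → (θ.ZhUnity F 2 ∧ θ.SlotsNondegenerate₁₃ F 2) → θ.Admissible F 2 →
      LiveSel F θ ∧ ZetaMeasurable F 2 θ.ζ)
    (hW : ∀ (F : T4Family) (θ : Stage13HParams F 2) (hP : θ.Provisos₁₃CoPH F 2), (θ.ZhUnity F 2 ∧ θ.SlotsNondegenerate₁₃ F 2) → θ.Admissible F 2 →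
      ∀ (g₀ : ℕ → ℝ) (os : List (ULoop F)), ∃ c w : ℕ → ℝ, (∀ K, 0 ≤ w K) ∧ Summable w ∧ ∀ (K : ℕ) (t : ℝ), |t| ≤ 1 →
        (∑ u ∈ classSetK₁₃ θ 0 g₀ (kr F θ hP g₀ os) K,
            max 0 (weightAK₁₃ θ hP 0 g₀ os (kr F θ hP g₀ os) K t u - Real.exp (-c K) * weightBK₁₃ θ hP 0 g₀ os (kr F θ hP g₀ os) K t u)
          ≤ w K * ∑ u ∈ classSetK₁₃ θ 0 g₀ (kr F θ hP g₀ os) K, weightAK₁₃ θ hP 0 g₀ os (kr F θ hP g₀ os) K t u) ∧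
        (∑ u ∈ classSetK₁₃ θ 0 g₀ (kr F θ hP g₀ os) K,
            max 0 (weightBK₁₃ θ hP 0 g₀ os (kr F θ hP g₀ os) K t u - Real.exp (c K) * weightAK₁₃ θ hP 0 g₀ os (kr F θ hP g₀ os) K t u)
          ≤ w K * ∑ u ∈ classSetK₁₃ θ 0 g₀ (kr F θ hP g₀ os) K, weightBK₁₃ θ hP 0 g₀ os (kr F θ hP g₀ os) K t u)) :
    Summit.QuantumFields.YangMills.Theses.BalabanUVNodes.SpineGivenEndpointR13SepCoPHV :=
  spineGivenEndpointR13SepCoPHV_of_ratesV_of_liveLine_of_l1LetterK kr β rr (keyedRatesHolderD4V_of_bFree hr) hlive hW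

/-- **★★ THE ASIDE K3⁷ DISPLAY `SpineGivenEndpointR13SepCoPH` (stmt-QuantumFields-20544) FROM THE SAME (B)-FREE RATES, LIVE LINE AND ONE LETTER AT `kr`** — dag-n19-w3's composer
`keyedGuarded₁₃CoPH_of_keyedFacesP_fsc` at `cr := crOfRecord₁₃K kr ⊥ sh⋆`, `G := ZhUnity ∧ SlotsNondegenerate₁₃`, `P := PHolderD4 β` (the road of the mirror's
`spineGivenEndpointR13SepCoPH_of_stubTextsBFree`), with §1's v5-shaped faces (`…_of_bFree` transfers).  ⊢ the K3⁷ decl BY NAME from DISPLAYED hypotheses — NOT a proof of K3⁷, credits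
nothing; both displays from ONE (B)-free road, as the (δⱽ) recipe promises. [bookkeeping] -/
theorem spineGivenEndpointR13SepCoPH_of_ratesBFree_of_liveLine_of_l1LetterK (β : ℝ) (rr : RateReadingFn) (hr : KeyedRatesHolderD4BFree β rr)
    (hlive : ∀ (F : T4Family) (θ : Stage13HParams F 2), θ.Provisos₁₃CoPH F 2 → (θ.ZhUnity F 2 ∧ θ.SlotsNondegenerate₁₃ F 2) → θ.Admissible F 2 →
      LiveSel F θ ∧ ZetaMeasurable F 2 θ.ζ)
    (hW : ∀ (F : T4Family) (θ : Stage13HParams F 2) (hP : θ.Provisos₁₃CoPH F 2), (θ.ZhUnity F 2 ∧ θ.SlotsNondegenerate₁₃ F 2) → θ.Admissible F 2 →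
      ∀ (g₀ : ℕ → ℝ) (os : List (ULoop F)), ∃ c w : ℕ → ℝ, (∀ K, 0 ≤ w K) ∧ Summable w ∧ ∀ (K : ℕ) (t : ℝ), |t| ≤ 1 →
        (∑ u ∈ classSetK₁₃ θ 0 g₀ (kr F θ hP g₀ os) K,
            max 0 (weightAK₁₃ θ hP 0 g₀ os (kr F θ hP g₀ os) K t u - Real.exp (-c K) * weightBK₁₃ θ hP 0 g₀ os (kr F θ hP g₀ os) K t u)
          ≤ w K * ∑ u ∈ classSetK₁₃ θ 0 g₀ (kr F θ hP g₀ os) K, weightAK₁₃ θ hP 0 g₀ os (kr F θ hP g₀ os) K t u) ∧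
        (∑ u ∈ classSetK₁₃ θ 0 g₀ (kr F θ hP g₀ os) K,
            max 0 (weightBK₁₃ θ hP 0 g₀ os (kr F θ hP g₀ os) K t u - Real.exp (c K) * weightAK₁₃ θ hP 0 g₀ os (kr F θ hP g₀ os) K t u)
          ≤ w K * ∑ u ∈ classSetK₁₃ θ 0 g₀ (kr F θ hP g₀ os) K, weightBK₁₃ θ hP 0 g₀ os (kr F θ hP g₀ os) K t u)) :
    Summit.QuantumFields.YangMills.Theses.BalabanUVNodes.SpineGivenEndpointR13SepCoPH := by
  obtain ⟨sh, h20, h21, hx, h19⟩ := exists_optShell_facesK_of_lettersK kr (fun _ _ _ _ _ _ _ => False) hlive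
    (fun _ θ hP _ _ g₀ os => exists_relWeightBound_carriersK_badFalse kr θ hP g₀ os) hW
  exact fun F θ hP hG hθ _ _ =>
    keyedGuarded₁₃CoPH_of_keyedFacesP_fsc (crOfRecord₁₃K kr (fun _ _ _ _ _ _ _ => False) sh) rr (fun θ => θ.ZhUnity _ 2 ∧ θ.SlotsNondegenerate₁₃ _ 2) (PHolderD4 β)
      h20 h21 (keyedRatesHolderD4_of_bFree hr) (keyedCoreEdgeHolderD4_of_bFree (h19 β rr)) (keyedExtraction_of_bFree hx) F θ hP.toCore hG hθ

end Item

end Summit.QuantumFields.YangMills.BalabanUVNodes.N20CoreEdgeShellDialAtKeyReadingK3V6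

end
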